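import Mathlib
import HarnessLib
import Literature.NumberTheory.EllipticCurves.LangHeightBernoulliPositivityProofs
import Summits.Ventures.LatticeQCDFlow.Scaling.AcceptanceGiniFloor

/-!
# LatticeQCDFlow / Scaling — the constant `1/3` in `(1 − acc)² ≤ (1/ESS − 1)/3` is best possible:
# the uniform ramp of `m` equally likely, equally spaced weights has `(1 − acc)² = ((m²−1)/(3m²))·(1/ESS − 1)`

HONEST FRAMING: exact (Metropolis-corrected) sampling algorithms for lattice gauge theory;
figures of merit are autocorrelation/cost numbers at stated couplings and volumes; no
continuum-physics claim.

Venture `LatticeQCDFlow` (cell pub-lqcd), topic `Scaling`; FANOUT row 3 (`s0-u1-a`, S0-B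
implementation A, GEN-6).  NEW WORK of the cell (power sums by induction and one explicit family),
not a published result; NO definition is introduced (the two laws of the witness are written out in
every statement).  Completes row 3's `Scaling/AcceptanceGiniFloorSharp`
(`sq_one_sub_accRate_le_third`: `(1 − acc)² ≤ (1/ESS − 1)/3` for every finite law), whose module
docstring records the sharpness of `1/3` as an untyped remark; here it is typed.  Uses row 3's
`Scaling/AcceptanceGiniFloor` identities `one_sub_accRate_eq_half_qq_abs_weight`
(`1 − acc = ½ E_{q⊗q}|w − w′|`) and `qq_sq_sub_weight_eq` (`E_{q⊗q}(w − w′)² = 2(1/ESS − 1)`).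

## Content

* `sum_range_abs_sub` — `Σ_iΣ_j |i − j| = (m−1)m(m+1)/3` over `range m` (induction), REUSING the
  tree's real power sums `Literature.NumberTheory.EllipticCurves.sum_range_natCast_real`
  (`Σ i = n(n−1)/2`) and `sum_range_natCast_sq_real` (`Σ i² = n(n−1)(2n−1)/6`); the second moment
  `Σ_iΣ_j (i − j)² = m²(m²−1)/6` (also in the tree, inside the Balaban `T4OneStepFactorisation` file,
  not imported here) is re-derived as a local step from those two sums;
  `sum_fin_fin_eq_sum_range_range` (bookkeeping `Fin m` ↔ `range m`);
* the UNIFORM RAMP on `Fin m`, `m ≥ 2`: model `q ≡ 1/m`, target `p_i = (1/m)(1 + (i − (m−1)/2)/m)`,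
  i.e. weights `w_i = 1 + (i − (m−1)/2)/m` (`uniformRamp_weight`), positive (`uniformRamp_pos`) and
  normalised (`uniformRamp_sum_eq_one`, `uniform_fin_sum_eq_one`);
* **`uniformRamp_one_sub_accRate`** — `1 − acc = (m² − 1)/(6m²)`;
  **`uniformRamp_inv_essFrac_sub_one`** — `1/ESS − 1 = (m² − 1)/(12m²)`;
  **`uniformRamp_sq_one_sub_accRate_eq`** — `(1 − acc)² = ((m² − 1)/(3m²))·(1/ESS − 1)` exactly;
* **`exists_sq_one_sub_accRate_gt_mul`** — for every `c < 1/3` there are a finite space and fully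
  supported normalised `p`, `q` with `c·(1/ESS − 1) < (1 − acc)²`: no constant below `1/3` can
  replace it in `sq_one_sub_accRate_le_third`.

Reading (value-free; nothing re-scored, no number of record moves): the ESS-to-acceptance floor
`acc ≥ 1 − √((1/ESS − 1)/3)` is the last word of its kind — among all laws with a given Kish fraction,
equally spaced equally likely weights make the equilibrium acceptance of the independence sampler as
small as that floor allows, up to the factor `1 − 1/m²`.  NOT CLAIMED: that the ramp is the unique
extremiser; anything about which trained flows produce ramp-like weights; any number of ours.

Elementary (`[folklore]`-level); farm `lean check` rc 0, no `sorry`.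
-/

namespace Summit.Ventures.LatticeQCDFlow.Theory2

open Finset
open Literature.Probability.MarkovChains
open Summit.Ventures.LatticeQCDFlow.Exactness

/-! ### Power sums over `range m` (real-valued) -/

/-- `Σ_{i<m} Σ_{j<m} |i − j| = (m−1)m(m+1)/3`. [folklore] -/
theorem sum_range_abs_sub (m : ℕ) :
    ∑ i ∈ range m, ∑ j ∈ range m, |(i : ℝ) - j| = (m - 1) * m * (m + 1) / 3 := by
  induction m with
  | zero => simp
  | succ k ih =>
    rw [sum_range_succ]
    simp_rw [sum_range_succ]
    rw [sum_add_distrib, ih, sub_self, abs_zero, add_zero]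
    have h2 : ∑ j ∈ range k, |(k : ℝ) - j| = k * (k + 1) / 2 := by
      have e : ∀ j ∈ range k, |(k : ℝ) - j| = (k : ℝ) - j := fun j hj =>
        abs_of_nonneg (sub_nonneg.2 (by exact_mod_cast (mem_range.1 hj).le))
      rw [sum_congr rfl e, sum_sub_distrib, sum_const, card_range, nsmul_eq_mul, Literature.NumberTheory.EllipticCurves.sum_range_natCast_real]
      ring
    have h1 : ∑ i ∈ range k, |(i : ℝ) - k| = k * (k + 1) / 2 := by
      rw [← h2]
      exact sum_congr rfl fun i _ => abs_sub_comm _ _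
    rw [h1, h2]
    push_cast
    ring

/-- A double sum over `Fin m × Fin m` of a function of the indices is the double sum over
`range m × range m`. [folklore] -/
theorem sum_fin_fin_eq_sum_range_range (m : ℕ) (g : ℕ → ℕ → ℝ) :
    ∑ i : Fin m, ∑ j : Fin m, g i j = ∑ i ∈ range m, ∑ j ∈ range m, g i j := by
  have h : ∀ i : Fin m, ∑ j : Fin m, g i j = ∑ j ∈ range m, g i j :=
    fun i => Fin.sum_univ_eq_sum_range (g i) m
  simp_rw [h]
  exact Fin.sum_univ_eq_sum_range (fun i => ∑ j ∈ range m, g i j) m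

/-! ### The uniform ramp: `m` equally likely states with linearly spaced weights

Model `q ≡ 1/m` on `Fin m`; target `p_i = (1/m)·(1 + (i − (m−1)/2)/m)`, i.e. importance weights
`w_i = 1 + (i − (m−1)/2)/m` — equally spaced, mean one, all positive for `m ≥ 2`.  The two laws are
written out in every statement (no definition is introduced). -/

/-- The ramp's importance weights: `w_i = 1 + (i − (m−1)/2)/m`. -/
theorem uniformRamp_weight {m : ℕ} (hm : 2 ≤ m) (i : Fin m) :
    weight (fun i : Fin m => ((m : ℝ))⁻¹ * (1 + (((i : ℕ) : ℝ) - ((m : ℝ) - 1) / 2) / m))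
        (fun _ : Fin m => ((m : ℝ))⁻¹) i
      = 1 + (((i : ℕ) : ℝ) - ((m : ℝ) - 1) / 2) / m := by
  have hmne : (m : ℝ) ≠ 0 := by exact_mod_cast (by omega : m ≠ 0)
  rw [weight]
  field_simp

/-- The ramp target is strictly positive (`w_i ≥ (m+1)/(2m) > 0`). -/
theorem uniformRamp_pos {m : ℕ} (hm : 2 ≤ m) (i : Fin m) :
    0 < ((m : ℝ))⁻¹ * (1 + (((i : ℕ) : ℝ) - ((m : ℝ) - 1) / 2) / m) := by
  have hm0 : (0 : ℝ) < m := by exact_mod_cast (by omega : 0 < m)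
  have hi : (0 : ℝ) ≤ ((i : ℕ) : ℝ) := Nat.cast_nonneg _
  refine mul_pos (inv_pos.2 hm0) ?_
  have h1 : (1 : ℝ) ≤ m := by exact_mod_cast (by omega : 1 ≤ m)
  have h2 : -(((m : ℝ) - 1) / 2) / m ≤ (((i : ℕ) : ℝ) - ((m : ℝ) - 1) / 2) / m :=
    div_le_div_of_nonneg_right (by linarith) hm0.le
  have h3 : -(((m : ℝ) - 1) / 2) / m = -1 / 2 + 1 / (2 * m) := by
    field_simp
    ring
  have h4 : (0 : ℝ) < 1 / (2 * m) := by positivity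
  linarith

/-- The ramp target is normalised. -/
theorem uniformRamp_sum_eq_one {m : ℕ} (hm : 2 ≤ m) :
    ∑ i : Fin m, ((m : ℝ))⁻¹ * (1 + (((i : ℕ) : ℝ) - ((m : ℝ) - 1) / 2) / m) = 1 := by
  have hmne : (m : ℝ) ≠ 0 := by exact_mod_cast (by omega : m ≠ 0)
  have e : ∀ i : Fin m, ((m : ℝ))⁻¹ * (1 + (((i : ℕ) : ℝ) - ((m : ℝ) - 1) / 2) / m)
      = ((m : ℝ))⁻¹ * (1 - ((m : ℝ) - 1) / (2 * m))
        + ((m : ℝ))⁻¹ * ((m : ℝ))⁻¹ * ((i : ℕ) : ℝ) := by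
    intro i; field_simp; ring
  rw [Finset.sum_congr rfl fun i _ => e i, sum_add_distrib, sum_const, card_univ,
    Fintype.card_fin, nsmul_eq_mul, ← mul_sum,
    Fin.sum_univ_eq_sum_range (fun i => ((i : ℕ) : ℝ)) m,
    Literature.NumberTheory.EllipticCurves.sum_range_natCast_real]
  field_simp
  ring

/-- The uniform model is normalised. [folklore] -/
theorem uniform_fin_sum_eq_one {m : ℕ} (hm : 2 ≤ m) : ∑ _i : Fin m, ((m : ℝ))⁻¹ = 1 := by
  have hmne : (m : ℝ) ≠ 0 := by exact_mod_cast (by omega : m ≠ 0)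
  rw [sum_const, card_univ, Fintype.card_fin, nsmul_eq_mul, mul_inv_cancel₀ hmne]

/-- **The ramp's acceptance deficit**: `1 − acc = (m² − 1)/(6m²)` (Gini mean difference of the
equally spaced weights, `Σ_{i,j<m}|i − j| = (m−1)m(m+1)/3`, through
`one_sub_accRate_eq_half_qq_abs_weight`). -/
theorem uniformRamp_one_sub_accRate {m : ℕ} (hm : 2 ≤ m) :
    1 - accRate (fun i : Fin m => ((m : ℝ))⁻¹ * (1 + (((i : ℕ) : ℝ) - ((m : ℝ) - 1) / 2) / m))
        (fun _ : Fin m => ((m : ℝ))⁻¹)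
      = (((m : ℝ)) ^ 2 - 1) / (6 * (m : ℝ) ^ 2) := by
  have hm0 : (0 : ℝ) < m := by exact_mod_cast (by omega : 0 < m)
  have hmne : (m : ℝ) ≠ 0 := hm0.ne'
  rw [one_sub_accRate_eq_half_qq_abs_weight (fun _ => inv_pos.2 hm0) (uniformRamp_sum_eq_one hm)
    (uniform_fin_sum_eq_one hm)]
  have e : ∀ i j : Fin m, ((m : ℝ))⁻¹ * ((m : ℝ))⁻¹ *
      |weight (fun i : Fin m => ((m : ℝ))⁻¹ * (1 + (((i : ℕ) : ℝ) - ((m : ℝ) - 1) / 2) / m))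
          (fun _ : Fin m => ((m : ℝ))⁻¹) i
        - weight (fun i : Fin m => ((m : ℝ))⁻¹ * (1 + (((i : ℕ) : ℝ) - ((m : ℝ) - 1) / 2) / m))
          (fun _ : Fin m => ((m : ℝ))⁻¹) j|
      = (((m : ℝ))⁻¹) ^ 3 * |((i : ℕ) : ℝ) - ((j : ℕ) : ℝ)| := by
    intro i j
    rw [uniformRamp_weight hm, uniformRamp_weight hm]
    have : (1 + (((i : ℕ) : ℝ) - ((m : ℝ) - 1) / 2) / m) - (1 + (((j : ℕ) : ℝ) - ((m : ℝ) - 1) / 2) / m)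
        = (((i : ℕ) : ℝ) - ((j : ℕ) : ℝ)) * ((m : ℝ))⁻¹ := by field_simp; ring
    rw [this, abs_mul, abs_of_pos (inv_pos.2 hm0)]
    ring
  simp_rw [e, ← mul_sum]
  rw [sum_fin_fin_eq_sum_range_range m (fun i j => |(i : ℝ) - (j : ℝ)|), sum_range_abs_sub]
  field_simp
  ring

/-- **The ramp's ESS**: `1/ESS − 1 = (m² − 1)/(12m²)` (the variance of the equally spaced weights,
`Σ_{i,j<m}(i − j)² = m²(m² − 1)/6`, through `qq_sq_sub_weight_eq`). -/
theorem uniformRamp_inv_essFrac_sub_one {m : ℕ} (hm : 2 ≤ m) :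
    (essFrac (fun i : Fin m => ((m : ℝ))⁻¹ * (1 + (((i : ℕ) : ℝ) - ((m : ℝ) - 1) / 2) / m))
        (fun _ : Fin m => ((m : ℝ))⁻¹))⁻¹ - 1
      = (((m : ℝ)) ^ 2 - 1) / (12 * (m : ℝ) ^ 2) := by
  have hm0 : (0 : ℝ) < m := by exact_mod_cast (by omega : 0 < m)
  have hmne : (m : ℝ) ≠ 0 := hm0.ne'
  have h2 := qq_sq_sub_weight_eq (fun _ => inv_pos.2 hm0) (uniformRamp_sum_eq_one hm)
    (uniform_fin_sum_eq_one hm) (p := fun i : Fin m =>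
      ((m : ℝ))⁻¹ * (1 + (((i : ℕ) : ℝ) - ((m : ℝ) - 1) / 2) / m)) (q := fun _ : Fin m => ((m : ℝ))⁻¹)
  have e : ∀ i j : Fin m, ((m : ℝ))⁻¹ * ((m : ℝ))⁻¹ *
      (weight (fun i : Fin m => ((m : ℝ))⁻¹ * (1 + (((i : ℕ) : ℝ) - ((m : ℝ) - 1) / 2) / m))
          (fun _ : Fin m => ((m : ℝ))⁻¹) i
        - weight (fun i : Fin m => ((m : ℝ))⁻¹ * (1 + (((i : ℕ) : ℝ) - ((m : ℝ) - 1) / 2) / m))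
          (fun _ : Fin m => ((m : ℝ))⁻¹) j) ^ 2
      = (((m : ℝ))⁻¹) ^ 4 * (((i : ℕ) : ℝ) - ((j : ℕ) : ℝ)) ^ 2 := by
    intro i j
    rw [uniformRamp_weight hm, uniformRamp_weight hm]
    field_simp
    ring
  simp_rw [e, ← mul_sum] at h2
  -- `Σ_{i,j<m} (i − j)² = m²(m² − 1)/6` from the two power sums
  have hsq : ∑ i ∈ range m, ∑ j ∈ range m, ((i : ℝ) - j) ^ 2
      = (m : ℝ) ^ 2 * ((m : ℝ) ^ 2 - 1) / 6 := by
    have ei : ∀ i j : ℕ, ((i : ℝ) - j) ^ 2 = (i : ℝ) ^ 2 - 2 * i * j + (j : ℝ) ^ 2 := fun i j => by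
      ring
    have hin : ∀ i : ℕ, ∑ j ∈ range m, ((i : ℝ) - j) ^ 2
        = m * (i : ℝ) ^ 2 - 2 * i * (m * (m - 1) / 2) + m * (m - 1) * (2 * m - 1) / 6 := by
      intro i
      simp_rw [ei]
      rw [sum_add_distrib, sum_sub_distrib, sum_const, card_range, nsmul_eq_mul, ← mul_sum,
        Literature.NumberTheory.EllipticCurves.sum_range_natCast_real,
        Literature.NumberTheory.EllipticCurves.sum_range_natCast_sq_real]
    simp_rw [hin]
    rw [sum_add_distrib, sum_sub_distrib, sum_const, card_range, nsmul_eq_mul, ← mul_sum,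
      Literature.NumberTheory.EllipticCurves.sum_range_natCast_sq_real]
    have e3 : ∑ i ∈ range m, 2 * (i : ℝ) * ((m : ℝ) * ((m : ℝ) - 1) / 2)
        = 2 * ((m : ℝ) * ((m : ℝ) - 1) / 2) * ((m : ℝ) * ((m : ℝ) - 1) / 2) := by
      rw [← Literature.NumberTheory.EllipticCurves.sum_range_natCast_real, mul_sum]
      exact sum_congr rfl fun i _ => by ring
    rw [e3]
    ring
  rw [sum_fin_fin_eq_sum_range_range m (fun i j => ((i : ℝ) - (j : ℝ)) ^ 2), hsq] at h2
  have e2 : (((m : ℝ)) ^ 2 - 1) / (12 * (m : ℝ) ^ 2)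
      = ((((m : ℝ))⁻¹) ^ 4 * ((m : ℝ) ^ 2 * ((m : ℝ) ^ 2 - 1) / 6)) / 2 := by
    field_simp
    ring
  rw [e2]
  linarith [h2]

/-- **The uniform-ramp identity**: `(1 − acc)² = ((m² − 1)/(3m²)) · (1/ESS − 1)` EXACTLY — the ratio
`(m² − 1)/(3m²)` increases to the constant `1/3` of `sq_one_sub_accRate_le_third`
(`Scaling/AcceptanceGiniFloorSharp`). -/
theorem uniformRamp_sq_one_sub_accRate_eq {m : ℕ} (hm : 2 ≤ m) :
    (1 - accRate (fun i : Fin m => ((m : ℝ))⁻¹ * (1 + (((i : ℕ) : ℝ) - ((m : ℝ) - 1) / 2) / m))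
        (fun _ : Fin m => ((m : ℝ))⁻¹)) ^ 2
      = (((m : ℝ)) ^ 2 - 1) / (3 * (m : ℝ) ^ 2)
        * ((essFrac (fun i : Fin m => ((m : ℝ))⁻¹ * (1 + (((i : ℕ) : ℝ) - ((m : ℝ) - 1) / 2) / m))
            (fun _ : Fin m => ((m : ℝ))⁻¹))⁻¹ - 1) := by
  have hmne : (m : ℝ) ≠ 0 := by exact_mod_cast (by omega : m ≠ 0)
  rw [uniformRamp_one_sub_accRate hm, uniformRamp_inv_essFrac_sub_one hm]
  field_simp
  ring

/-- **The constant `1/3` is best possible.**  For every `c < 1/3` there is a finite state space with a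
fully supported, normalised target and model whose acceptance deficit satisfies
`(1 − acc)² > c·(1/ESS − 1)` — so `sq_one_sub_accRate_le_third` (`(1 − acc)² ≤ (1/ESS − 1)/3`) cannot
be improved by a smaller constant valid for all finite laws.  Witness: the uniform ramp on `Fin m`
with `m > 1/(1 − 3c)`. -/
theorem exists_sq_one_sub_accRate_gt_mul {c : ℝ} (hc : c < 1 / 3) :
    ∃ (m : ℕ) (p q : Fin m → ℝ), (∀ i, 0 < p i) ∧ (∀ i, 0 < q i) ∧ ∑ i, p i = 1 ∧ ∑ i, q i = 1 ∧
      c * ((essFrac p q)⁻¹ - 1) < (1 - accRate p q) ^ 2 := by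
  obtain ⟨m₀, hm₀⟩ := exists_nat_gt (1 / (1 - 3 * c))
  set m := m₀ + 2 with hm_def
  have hm : 2 ≤ m := by omega
  have hm0 : (0 : ℝ) < m := by exact_mod_cast (by omega : 0 < m)
  have hmgt : 1 / (1 - 3 * c) < (m : ℝ) := by
    have : (m₀ : ℝ) ≤ m := by rw [hm_def]; push_cast; linarith
    linarith
  refine ⟨m, fun i : Fin m => ((m : ℝ))⁻¹ * (1 + (((i : ℕ) : ℝ) - ((m : ℝ) - 1) / 2) / m),
    fun _ : Fin m => ((m : ℝ))⁻¹, uniformRamp_pos hm, fun _ => inv_pos.2 hm0,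
    uniformRamp_sum_eq_one hm, uniform_fin_sum_eq_one hm, ?_⟩
  rw [uniformRamp_sq_one_sub_accRate_eq hm, uniformRamp_inv_essFrac_sub_one hm]
  -- `c < (m² − 1)/(3m²)` from `m(1 − 3c) > 1` and `m² ≥ m`
  have h13 : 0 < 1 - 3 * c := by linarith
  have hm1 : 1 < (m : ℝ) * (1 - 3 * c) := by
    have := (div_lt_iff₀ h13).1 hmgt
    linarith
  have hmsq : (m : ℝ) ≤ (m : ℝ) ^ 2 := by
    have h1 : (1 : ℝ) ≤ m := by exact_mod_cast (by omega : 1 ≤ m)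
    nlinarith
  have hc' : c < (((m : ℝ)) ^ 2 - 1) / (3 * (m : ℝ) ^ 2) := by
    rw [lt_div_iff₀ (by positivity)]
    nlinarith
  have hpos : 0 < (((m : ℝ)) ^ 2 - 1) / (12 * (m : ℝ) ^ 2) := by
    have h2 : (2 : ℝ) ≤ m := by exact_mod_cast hm
    apply div_pos _ (by positivity)
    nlinarith
  exact mul_lt_mul_of_pos_right hc' hpos

end Summit.Ventures.LatticeQCDFlow.Theory2
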